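import Mathlib
import Literature.Probability.LatticeModels.LatticeGraph
import HarnessLib

/-!
# The multi-component lattice sine-Gordon (vector Coulomb gas) measure on the discrete torus

Topic `Probability/LatticeModels`.  Definition file (no named facts) supplying the vocabulary in
which route `QuantumFields/QCD/CentreStabilisedCircle` wants to type its informal support item
`RootLatticeDebyeScreening` (stmt-QuantumFields-9755: Debye screening of the `A₂` monopole gas;
"still wanted: `latticeSineGordonGas` … to type RootLatticeDebyeScreening", route file rev 6) and
route `QuantumFields/YangMills/SmallCircleAnchor` its foreseen `CoulombGasMeasure` ("sine-Gordon /
integer-current Coulomb gas on (ℤ/L)³ with Gaussian covariance (−Δ)⁻¹ and fugacity z").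

The finite-volume lattice sine-Gordon measure with `k` field components and a finite family of
charge vectors `α : ι → ℝᵏ` on the torus `(ℤ/N)ᵈ`:

  `dμ(φ) ∝ exp( −(2g²)⁻¹ [Σ_x Σ_i |φ(x+eᵢ) − φ(x)|² + ε Σ_x |φ(x)|²] + 2ζ Σ_x Σ_r cos(α_r · φ(x)) ) dφ`,

`dφ` the Lebesgue measure on `((ℤ/N)ᵈ × Fin k) → ℝ` (components `φ (x, a)`).  This is the
sine-Gordon representation of the lattice Coulomb gas of charges `±α_r` with activity `∝ ζ` and
Coulomb kernel `g²(−Δ_N + ε)⁻¹`: Brydges 1978 §1.2 and (2.7) (one component, charges `±1`,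
`exp(2z ∫ cos β^{1/2}φ) ↔ ∫ dφ_v exp(2z ∫ :cos β^{1/2}φ:)`), Brydges–Martin 1999 §2.5; for `k = 2`
and `α` the positive roots of `A₂` it is the dual-photon / monopole-plasma measure of
centre-symmetric `SU(3)` on `ℝ³ × S¹` (Ünsal–Yaffe 2008 §3: monopole charges `∝` the simple and
affine roots `α₁, α₂, α₀ = −α₁−α₂`, which for `N_c = 3` are the positive roots up to sign).

## What the sources print

Brydges 1978, §1.2: "exp 2z∫_Λ dk(x) cos β^{1/2}φ(x) = ∫ dφ_v exp 2z ∫_Λ dx :cos β^{1/2}φ(x):"; §2,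
(2.7): "By the Sine Gordon transformation `Z(Λ) = ∫ dφ_{v_Λ} e^{U(Λ)}`,
`U(Λ) = l_L^{-1} ∫_Λ dx (:cos l_L^{1/2} φ(x): − 1)`", with `v_Λ` "the kernel of `(−Δ + ξ_{∼Λ})⁻¹`"
(massless inside `Λ`, unit mass outside).  Ünsal–Yaffe 2008 §3: "we are dealing with a
multi-component classical plasma … The grand canonical partition function of this multi-component
Coulomb gas is `Z = Π_i {Σ_n ζⁿ/n! Σ_n̄ ζ^n̄/n̄! ∫…} e^{−S_int}`", `S_int = (2π²L/g²) Σ α_i·α_j […G…]`.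

## Contents

* `Config d N k`, `gaussianAction`, `pairing`, `tilt`, `weight`, `partitionFunction`, `expect`,
  `truncCorr`, `cosObs`;
* proved API: `weight_pos`, `abs_tilt_le`, `gaussianAction_nonneg`, `massTerm_le_gaussianAction`,
  `weight_le_gaussianBound`, `continuous_weight`, `integrable_weight`, `integrable_mul_weight`
  (bounded measurable observables), `partitionFunction_pos`, `expect_one`, `abs_expect_le`;
* `a2Root` — the positive roots of `A₂` with `|α|² = 2` — and `a2Root_normSq`, `a2Root_two_eq_add`,
  `sum_a2Root_pairing_sq` (`Σ_r (α_r·v)² = 3|v|²`: isotropy of the Debye–Hückel form, Debye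
  mass² `6ζg²` for the `A₂` gas).

## Design choices and flags

* PERIODIC boundary conditions with a uniform regulator `ε` (covariance `g²(−Δ_N + ε)⁻¹`): this is
  what the requesting routes need (volume-uniform statements on spatial tori); `ε > 0` regularises
  the constant zero mode of `−Δ_N` (`partitionFunction_pos`, `integrable_weight` need `ε > 0`,
  `g ≠ 0`).  Brydges' own covariance is grounded outside a box of `l·ℤ³ ⊂ ℝ³` — a different
  object, deliberately NOT defined here (state it when a Brydges1978 named fact is vendored).
* The cosine is NOT normal-ordered and the tilt carries the factor `2ζ` (`e^{2z∫cos}`); Brydges'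
  activity differs by the constant `e^{g²|α|²G_ε(0)/2}` per charge, Ünsal–Yaffe's `ζ` by the same
  kind of constant.  Documented, not hidden: statements quantify over small `ζ` anyway.
* Flat configurations `(x, a) ↦ φ (x, a)` rather than `x ↦ ℝᵏ`: the Lebesgue measure is then the
  plain `Measure.pi` (`volume`), and `Integrable.fintype_prod` applies verbatim.
* Real-valued expectations as ratios of Bochner integrals; `expect` of a non-integrable `F` is the
  junk value `0 / Z` or `(junk)/Z` — every statement should feed bounded measurable observables
  (`integrable_mul_weight`, `abs_expect_le`).
* NOT here: the charge (Coulomb-gas) expansion `e^{2ζ cos θ} = Σ_n I_n(2ζ) e^{inθ}` and the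
  identification with an integer-current / point-charge ensemble (cf. `VillainCoulombGas`,
  `DiracCombResummation`); infinite-volume limits; Debye screening itself (no theorem of that kind
  is claimed — for vector charges on a torus none is published, see the audit on
  stmt-QuantumFields-9755).
* Mathlib / tree search (2026-08-16): Mathlib has no lattice sine-Gordon / Coulomb gas; the tree
  has `TorusSite`, `torusLaplacian` (`WeaklySAWTorusFeynmanKac`), Villain/Coulomb-gas algebra for
  `U(1)` gauge theory (`CoulombGasAlgebra`, `VillainCoulombGas`), cosine-tilt lower bounds
  (`CosineTiltLowerBound`, `FrohlichSpencerCosineLowerBound`) — none defines this measure.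

## References

* D. C. Brydges, *A rigorous approach to Debye screening in dilute classical Coulomb systems*,
  Comm. Math. Phys. 58 (1978) 313–350, §1.2, §2. [Brydges1978]
* D. C. Brydges, Ph. A. Martin, *Coulomb systems at low density: a review*, J. Stat. Phys. 96
  (1999) 1163–1330, §2.5–2.7. [BrydgesMartin1999]
* M. Ünsal, L. G. Yaffe, *Center-stabilized Yang–Mills theory: confinement and large N volume
  independence*, Phys. Rev. D 78 (2008) 065035, §3. [UnsalYaffe2008]
-/

noncomputable section

open MeasureTheory Finset Real
open scoped BigOperators

namespace Literature.Probability.LatticeModels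

namespace LatticeSineGordon

/-- Field configurations on the torus `(ℤ/N)ᵈ` with `k` real components, stored flat:
`φ (x, a)` is the `a`-th component at the site `x`. [folklore] -/
abbrev Config (d N k : ℕ) : Type := TorusSite d N × Fin k → ℝ

variable {d N k : ℕ} [NeZero N] {ι : Type*} [Fintype ι]

/-- The Gaussian action `(2g²)⁻¹ [Σ_x Σ_i Σ_a (φ(x+eᵢ)_a − φ(x)_a)² + ε Σ_{(x,a)} φ(x)_a²]`, i.e. the
field has covariance `g² (−Δ_N + ε)⁻¹ ⊗ 1_k` (massive lattice free field on the torus; Brydges 1978 §2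
uses instead the grounded covariance `(−Δ_l + ξ_{∼Λ})⁻¹` on `l·ℤ³`). [folklore] -/
def gaussianAction (g ε : ℝ) (φ : Config d N k) : ℝ :=
  (2 * g ^ 2)⁻¹ *
    ((∑ x : TorusSite d N, ∑ i : Fin d, ∑ a : Fin k, (φ (x + Pi.single i 1, a) - φ (x, a)) ^ 2) +
      ε * ∑ p : TorusSite d N × Fin k, φ p ^ 2)

/-- The pairing `α · φ(x) = Σ_a α_a φ(x)_a` of a charge vector with the field at a site. [folklore] -/
def pairing (α : Fin k → ℝ) (φ : Config d N k) (x : TorusSite d N) : ℝ :=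
  ∑ a : Fin k, α a * φ (x, a)

/-- The sine-Gordon tilt `2ζ Σ_x Σ_r cos(α_r · φ(x))`. [cite: Brydges1978, §1.2 (e^{2z ∫ cos})] -/
def tilt (α : ι → Fin k → ℝ) (ζ : ℝ) (φ : Config d N k) : ℝ :=
  2 * ζ * ∑ x : TorusSite d N, ∑ r : ι, Real.cos (pairing (α r) φ x)

/-- The Boltzmann weight `exp(−S_Gauss(φ) + tilt(φ))`. [cite: Brydges1978, (2.7)] -/
def weight (α : ι → Fin k → ℝ) (g ε ζ : ℝ) (φ : Config d N k) : ℝ :=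
  Real.exp (-gaussianAction g ε φ + tilt α ζ φ)

/-- The partition function `Z = ∫ e^{−S+V} dφ` (Lebesgue measure on `Config d N k`). [cite: Brydges1978, (2.7)] -/
def partitionFunction (α : ι → Fin k → ℝ) (g ε ζ : ℝ) : ℝ :=
  ∫ φ : Config d N k, weight α g ε ζ φ

/-- The expectation `⟨F⟩ = ∫ F e^{−S+V} dφ / Z`. [cite: Brydges1978, (2.4), (2.8)] -/
def expect (α : ι → Fin k → ℝ) (g ε ζ : ℝ) (F : Config d N k → ℝ) : ℝ :=
  (∫ φ : Config d N k, F φ * weight α g ε ζ φ) / partitionFunction (d := d) (N := N) α g ε ζ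

/-- The truncated (connected) two-point function `⟨F G⟩ − ⟨F⟩⟨G⟩`. [folklore] -/
def truncCorr (α : ι → Fin k → ℝ) (g ε ζ : ℝ) (F G : Config d N k → ℝ) : ℝ :=
  expect α g ε ζ (fun φ => F φ * G φ) - expect α g ε ζ F * expect α g ε ζ G

/-- The charge-insertion observable `cos(β · φ(x))`. [folklore] -/
def cosObs (β : Fin k → ℝ) (x : TorusSite d N) (φ : Config d N k) : ℝ :=
  Real.cos (pairing β φ x)

/-! ### Basic API -/

/-- The weight is strictly positive. [folklore] -/
theorem weight_pos (α : ι → Fin k → ℝ) (g ε ζ : ℝ) (φ : Config d N k) : 0 < weight α g ε ζ φ :=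
  Real.exp_pos _

/-- `|tilt| ≤ 2|ζ| · #sites · #charges`. [folklore] -/
theorem abs_tilt_le (α : ι → Fin k → ℝ) (ζ : ℝ) (φ : Config d N k) :
    |tilt α ζ φ| ≤ 2 * |ζ| * (Fintype.card (TorusSite d N) * Fintype.card ι) := by
  unfold tilt
  rw [abs_mul, abs_mul, abs_two]
  refine mul_le_mul_of_nonneg_left ?_ (by positivity)
  calc |∑ x : TorusSite d N, ∑ r : ι, Real.cos (pairing (α r) φ x)|
      ≤ ∑ x : TorusSite d N, |∑ r : ι, Real.cos (pairing (α r) φ x)| := abs_sum_le_sum_abs _ _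
    _ ≤ ∑ x : TorusSite d N, ∑ r : ι, |Real.cos (pairing (α r) φ x)| :=
        sum_le_sum fun x _ => abs_sum_le_sum_abs _ _
    _ ≤ ∑ _x : TorusSite d N, ∑ _r : ι, (1 : ℝ) :=
        sum_le_sum fun x _ => sum_le_sum fun r _ => Real.abs_cos_le_one _
    _ = (Fintype.card (TorusSite d N) * Fintype.card ι) := by
        simp [sum_const, Finset.card_univ]

/-- For `ε ≥ 0` the Gaussian action is non-negative. [folklore] -/
theorem gaussianAction_nonneg (g : ℝ) {ε : ℝ} (hε : 0 ≤ ε) (φ : Config d N k) :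
    0 ≤ gaussianAction g ε φ := by
  unfold gaussianAction
  refine mul_nonneg (by positivity) (add_nonneg ?_ (mul_nonneg hε ?_))
  · exact sum_nonneg fun _ _ => sum_nonneg fun _ _ => sum_nonneg fun _ _ => sq_nonneg _
  · exact sum_nonneg fun _ _ => sq_nonneg _

/-- The mass term alone bounds the action from below:
`(2g²)⁻¹ ε Σ_p φ_p² ≤ S_Gauss(φ)` (the gradient part is non-negative). [folklore] -/
theorem massTerm_le_gaussianAction (g ε : ℝ) (φ : Config d N k) :
    (2 * g ^ 2)⁻¹ * (ε * ∑ p : TorusSite d N × Fin k, φ p ^ 2) ≤ gaussianAction g ε φ := by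
  unfold gaussianAction
  refine mul_le_mul_of_nonneg_left (le_add_of_nonneg_left ?_) (by positivity)
  exact sum_nonneg fun _ _ => sum_nonneg fun _ _ => sum_nonneg fun _ _ => sq_nonneg _

/-- The product-Gaussian majorant of the weight:
`weight ≤ e^{2|ζ| #sites #charges} · Π_p exp(−(2g²)⁻¹ ε φ_p²)` (any real `ε`). [folklore] -/
theorem weight_le_gaussianBound (α : ι → Fin k → ℝ) (g ε ζ : ℝ) (φ : Config d N k) :
    weight α g ε ζ φ ≤ Real.exp (2 * |ζ| * (Fintype.card (TorusSite d N) * Fintype.card ι)) *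
      ∏ p : TorusSite d N × Fin k, Real.exp (-((2 * g ^ 2)⁻¹ * ε) * φ p ^ 2) := by
  rw [← Real.exp_sum, ← Real.exp_add, weight]
  refine Real.exp_le_exp.2 ?_
  have h1 := massTerm_le_gaussianAction g ε φ
  have h2 := (abs_le.1 (abs_tilt_le α ζ φ)).2
  have h3 : ∑ p : TorusSite d N × Fin k, -((2 * g ^ 2)⁻¹ * ε) * φ p ^ 2 =
      -((2 * g ^ 2)⁻¹ * (ε * ∑ p : TorusSite d N × Fin k, φ p ^ 2)) := by
    rw [mul_sum, mul_sum, ← sum_neg_distrib]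
    refine sum_congr rfl fun p _ => by ring
  rw [h3]
  linarith

/-- The weight is continuous in the field. [folklore] -/
theorem continuous_weight (α : ι → Fin k → ℝ) (g ε ζ : ℝ) :
    Continuous (weight (d := d) (N := N) α g ε ζ) := by
  unfold weight gaussianAction tilt pairing
  fun_prop

/-- The weight is integrable for `ε > 0` and `g ≠ 0`. [folklore] -/
theorem integrable_weight (α : ι → Fin k → ℝ) {g ε : ℝ} (hg : g ≠ 0) (hε : 0 < ε) (ζ : ℝ) :
    Integrable (weight (d := d) (N := N) α g ε ζ) := by
  have hb : 0 < (2 * g ^ 2)⁻¹ * ε := mul_pos (inv_pos.2 (by positivity)) hε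
  have hprod : Integrable (fun φ : Config d N k =>
      ∏ p : TorusSite d N × Fin k, Real.exp (-((2 * g ^ 2)⁻¹ * ε) * φ p ^ 2)) :=
    Integrable.fintype_prod (f := fun _ : TorusSite d N × Fin k => fun t : ℝ =>
      Real.exp (-((2 * g ^ 2)⁻¹ * ε) * t ^ 2)) fun _ => integrable_exp_neg_mul_sq hb
  refine (hprod.const_mul (Real.exp (2 * |ζ| * (Fintype.card (TorusSite d N) * Fintype.card ι)))).mono'
    (continuous_weight α g ε ζ).aestronglyMeasurable (Filter.Eventually.of_forall fun φ => ?_)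
  have hw := weight_pos α g ε ζ φ
  have hle := weight_le_gaussianBound α g ε ζ φ
  simpa only [Real.norm_eq_abs, abs_of_pos hw] using hle

/-- A bounded, (ae-strongly) measurable observable times the weight is integrable. [folklore] -/
theorem integrable_mul_weight (α : ι → Fin k → ℝ) {g ε : ℝ} (hg : g ≠ 0) (hε : 0 < ε) (ζ : ℝ)
    {F : Config d N k → ℝ} (hF : AEStronglyMeasurable F volume) {M : ℝ} (hM : ∀ φ, |F φ| ≤ M) :
    Integrable (fun φ : Config d N k => F φ * weight α g ε ζ φ) := by
  refine ((integrable_weight α hg hε ζ).const_mul M).mono' (hF.mul (continuous_weight α g ε ζ).aestronglyMeasurable)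
    (Filter.Eventually.of_forall fun φ => ?_)
  have hw := weight_pos α g ε ζ φ
  have hle : |F φ| * weight α g ε ζ φ ≤ M * weight α g ε ζ φ := mul_le_mul_of_nonneg_right (hM φ) hw.le
  simpa only [Real.norm_eq_abs, abs_mul, abs_of_pos hw] using hle

/-- The partition function is strictly positive (`ε > 0`, `g ≠ 0`). [folklore] -/
theorem partitionFunction_pos (α : ι → Fin k → ℝ) {g ε : ℝ} (hg : g ≠ 0) (hε : 0 < ε) (ζ : ℝ) :
    0 < partitionFunction (d := d) (N := N) α g ε ζ := by
  unfold partitionFunction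
  rw [integral_pos_iff_support_of_nonneg (fun φ => (weight_pos α g ε ζ φ).le) (integrable_weight α hg hε ζ)]
  have hsupp : Function.support (weight (d := d) (N := N) α g ε ζ) = Set.univ :=
    Set.eq_univ_of_forall fun φ => (weight_pos α g ε ζ φ).ne'
  rw [hsupp]
  exact isOpen_univ.measure_pos volume Set.univ_nonempty

/-- `⟨1⟩ = 1`. [folklore] -/
theorem expect_one (α : ι → Fin k → ℝ) {g ε : ℝ} (hg : g ≠ 0) (hε : 0 < ε) (ζ : ℝ) :
    expect (d := d) (N := N) α g ε ζ (fun _ => 1) = 1 := by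
  unfold expect
  simp only [one_mul]
  exact div_self (partitionFunction_pos α hg hε ζ).ne'

/-- `|⟨F⟩| ≤ M` when `|F| ≤ M` pointwise (bounded measurable `F`). [folklore] -/
theorem abs_expect_le (α : ι → Fin k → ℝ) {g ε : ℝ} (hg : g ≠ 0) (hε : 0 < ε) (ζ : ℝ)
    {F : Config d N k → ℝ} (hF : AEStronglyMeasurable F volume) {M : ℝ} (hM : ∀ φ, |F φ| ≤ M) :
    |expect α g ε ζ F| ≤ M := by
  have hZ := partitionFunction_pos (d := d) (N := N) α hg hε ζ
  unfold expect
  rw [abs_div, abs_of_pos hZ, div_le_iff₀ hZ]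
  calc |∫ φ : Config d N k, F φ * weight α g ε ζ φ|
      ≤ ∫ φ : Config d N k, |F φ * weight α g ε ζ φ| := abs_integral_le_integral_abs
    _ ≤ ∫ φ : Config d N k, M * weight α g ε ζ φ := by
        refine integral_mono (integrable_mul_weight α hg hε ζ hF hM).abs
          ((integrable_weight α hg hε ζ).const_mul M) fun φ => ?_
        have hw := weight_pos α g ε ζ φ
        have hle : |F φ| * weight α g ε ζ φ ≤ M * weight α g ε ζ φ := mul_le_mul_of_nonneg_right (hM φ) hw.le
        simpa only [abs_mul, abs_of_pos hw] using hle
    _ = M * partitionFunction (d := d) (N := N) α g ε ζ := by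
        rw [integral_const_mul]; rfl

end LatticeSineGordon

/-! ### The `A₂` charge family -/

/-- The three positive roots of `A₂` in an orthonormal basis of the Cartan plane, normalised to
`|α|² = 2`: `α₁ = (√2, 0)`, `α₂ = (−√2/2, √6/2)`, `α₃ = α₁ + α₂`.  Up to sign these are also the
affine simple roots `α₁, α₂, α₀ = −(α₁+α₂)` carried by the three monopole-instanton species of
centre-symmetric `SU(3)` on `ℝ³ × S¹`. [cite: UnsalYaffe2008, §3 (monopole charges ∝ simple and affine roots)] -/
def a2Root : Fin 3 → Fin 2 → ℝ
  | 0 => ![Real.sqrt 2, 0]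
  | 1 => ![-(Real.sqrt 2) / 2, Real.sqrt 6 / 2]
  | 2 => ![Real.sqrt 2 / 2, Real.sqrt 6 / 2]

/-- `|α_r|² = 2`. [folklore] -/
theorem a2Root_normSq (r : Fin 3) : ∑ a : Fin 2, a2Root r a ^ 2 = 2 := by
  have h2 := Real.sq_sqrt (show (0 : ℝ) ≤ 2 by norm_num)
  have h6 := Real.sq_sqrt (show (0 : ℝ) ≤ 6 by norm_num)
  fin_cases r <;> simp [a2Root, Fin.sum_univ_two] <;> nlinarith

/-- `α₃ = α₁ + α₂`. [folklore] -/
theorem a2Root_two_eq_add : a2Root 2 = a2Root 0 + a2Root 1 := by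
  funext a
  fin_cases a
  · simp [a2Root]; ring
  · simp [a2Root]

/-- Isotropy of the Debye–Hückel quadratic form of the `A₂` gas: `Σ_r (α_r · v)² = 3 |v|²`
(so the quadratic approximation of `2ζ Σ_r cos(α_r·φ)` is `6ζ − 3ζ|φ|²`, Debye mass² `6ζg²`).
[folklore] -/
theorem sum_a2Root_pairing_sq (v : Fin 2 → ℝ) :
    ∑ r : Fin 3, (∑ a : Fin 2, a2Root r a * v a) ^ 2 = 3 * ∑ a : Fin 2, v a ^ 2 := by
  have h2 := Real.sq_sqrt (show (0 : ℝ) ≤ 2 by norm_num)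
  have h6 := Real.sq_sqrt (show (0 : ℝ) ≤ 6 by norm_num)
  have h12 : Real.sqrt 2 * Real.sqrt 6 = 2 * Real.sqrt 3 := by
    rw [← Real.sqrt_mul (by norm_num : (0:ℝ) ≤ 2), show (2:ℝ) * 6 = 2 ^ 2 * 3 by norm_num,
      Real.sqrt_mul (by norm_num : (0:ℝ) ≤ 2 ^ 2), Real.sqrt_sq (by norm_num : (0:ℝ) ≤ 2)]
  simp only [Fin.sum_univ_three, Fin.sum_univ_two, a2Root, Matrix.cons_val_zero, Matrix.cons_val_one]
  nlinarith [h2, h6, h12]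

end Literature.Probability.LatticeModels
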